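import Mathlib.Algebra.CharP.Two
import Mathlib.Algebra.MvPolynomial.CommRing
import Mathlib.Data.Fin.VecNotation
import Mathlib.RingTheory.MvPolynomial.Ideal
import Mathlib.RingTheory.MvPowerSeries.Order
import Mathlib.Algebra.Field.ZMod
import Mathlib.Tactic.LinearCombination
import Mathlib.Tactic.Ring
import Literature.AlgebraicGeometry.Resolution.BenitoVillamayor2013Cleaning
import Literature.RingTheory.MvPowerSeries.MaximalIdealPow
import Summits.ResolutionOfSingularities.ResolutionOfSingularities.Theorems.MarkedTransferCampaignW22TranslationCleaning
import HarnessLib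

/-!
# K2.2-S through ONE DOMINO on GAP-LEDGER R05's witness W1 — kernel certificate rows (cell res-hironaka, rung L, slot W2.2)

[OURS · L1 W2.2 / kill test K2.2, supplement K2.2-S; seat res-L1-k22 gen 3] Evidence file (`lean check`, build_tag res).
Nothing here is a statement of Hironaka's manuscript (its items are CANDIDATES under adjudication) or of the cited papers;
what is typed are polynomial identities over `𝔽₂` and one order computation, certifying in the kernel the rows that the
kill test's kit job j261337 (tableS.json sha16 fe7607e8cb67bbdd, §B) reported as numbers and that pub-rosobs-carver asked to
have as citable certificate rows (cell STATUS 2026-08-26T23:10:02Z): on W1 (`p = 2`, `q = 2`,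
`g = y² + ε`, `ε = yω₁⁵ω₂ + yω₁ω₂ + ω₁⁴`, ambient `𝔽₂[y, ω₁, ω₂] = MvPolynomial (Fin 3) (ZMod 2)`, `0 = y, 1 = ω₁, 2 = ω₂`)

* **BV makes no step at `ξ`** (`BVCaseAOnW1`): for the `p`-presentation polynomial `f = z² + a₁ z + a₂`,
  `a₁ = ω₁⁵ω₂ + ω₁ω₂`, `a₂ = ω₁⁴` over `𝔽₂⟦ω₁, ω₂⟧`, the orders are `ν(a₁) = 2`, `ν(a₂) = 4`, so the sharpened case B)
  condition (5.3.1) of [BenitoVillamayoru2013] Prop. 5.3 (`BV2013.IsCaseB`, typed by res-lit-3, tree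
  `Literature/AlgebraicGeometry/Resolution/BenitoVillamayor2013Cleaning.lean`) FAILS for every value of the parameter
  `ρ = ord(ℛ_{𝒢,β})(ξ)` (`bvW1_not_isCaseB`; slope `= min(2, ρ)`, `bvW1_slope`); under the conclusion of Thm. 4.6
  (`BV2013.SlopeDichotomy`, hypothesis) the presentation is in case A) (`bvW1_isCaseA_of_slopeDichotomy`) and, for
  `ρ > 0`, WELL-ADAPTED (Def. 5.5 (1), `bvW1_isWellAdapted_of_slopeDichotomy`): no slope-raising translation exists, the
  cleaning procedure of Rem. 5.7 stops at once, the output section is `y` itself (`ω₁⁴` survives in the tail).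
* **Point blow-up of `ξ`, chart `ω₁`** (`y = y′ω₁`, `ω₂ = ω₂′ω₁`, exceptional divisor `ω₁ = 0`; the substitution is the
  `𝔽₂`-algebra endomorphism `aeval ![yω₁, ω₁, ω₂ω₁]`, primes dropped in statements):
  BV lineage (section `y`): `g ↦ ω₁² · g′_BV`, `g′_BV = y² + yω₁⁵ω₂ + yω₁ω₂ + ω₁²`; at the origin `ξ′` of the chart
  `g′_BV − y² ∉ 𝔪³` (order `2 = q`: the transformed section is no longer order-safe) while
  `g′_BV − (y + ω₁)² = yω₁ω₂(ω₁⁴ + 1) ∈ 𝔪³` with the LINEAR re-translation `ω₁ ∉ 𝔪²` — «the tail turns»;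
  CS lineage (vertex-prepared section `z = y + ω₁²`; in the coordinates `(z, ω₁, ω₂)`
  `g = z² + zω₁⁵ω₂ + zω₁ω₂ + ω₁⁷ω₂ + ω₁³ω₂`): `g ↦ ω₁² · g′_CS`, `g′_CS = z² + zω₁ω₂ + zω₁⁵ω₂ + ω₁²ω₂ + ω₁⁶ω₂`, and
  `g′_CS − z² ∈ 𝔪³` with NO re-translation — «the tail persists»; indeed the re-linearised BV section IS the CS section,
  `g′_BV(z + ω₁, ω₁, ω₂) = g′_CS` (`z′ = y′ + ω₁`).
No claim beyond these identities (in particular none about later blow-ups, and none about the manuscript's H♭).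
Companion rows: `Campaign.W22.HCS_W1_not_mem_axis_ideal_cube` / `HBV_W1_not_mem_axis_ideal_cube` (P3 column) in
`MarkedTransferCampaignW22TranslationCleaning.lean`. No definitions, no instances, no notation.
-/

set_option linter.dupNamespace false -- mandated namespace of this single-conjunct summit

namespace Summit.ResolutionOfSingularities.ResolutionOfSingularities.Theorems.Campaign.W22

section OneDominoW1

open MvPolynomial

/-! ### The ideal `𝔪 = (y, ω₁, ω₂)` of `ξ` and the order test -/

/-- [folklore] `𝔪 = (y, ω₁, ω₂)` is Mathlib's ideal of all variables of `𝔽₂[y, ω₁, ω₂]`. -/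
theorem span_vars_eq_idealOfVars :
    Ideal.span ({X 0, X 1, X 2} : Set (MvPolynomial (Fin 3) (ZMod 2))) =
      MvPolynomial.idealOfVars (Fin 3) (ZMod 2) := by
  simp only [MvPolynomial.idealOfVars]
  congr 1
  ext p
  simp only [Set.mem_insert_iff, Set.mem_singleton_iff, Set.mem_range]
  constructor
  · rintro (rfl | rfl | rfl)
    · exact ⟨0, rfl⟩
    · exact ⟨1, rfl⟩
    · exact ⟨2, rfl⟩
  · rintro ⟨i, rfl⟩
    fin_cases i <;> simp

/-- [folklore] Order test for powers of variables: `X i ^ e ∈ 𝔪ⁿ ↔ n ≤ e` in `𝔽₂[y, ω₁, ω₂]`. -/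
theorem X_pow_mem_vars_pow_iff (i : Fin 3) (e n : ℕ) :
    (X i : MvPolynomial (Fin 3) (ZMod 2)) ^ e ∈
        (Ideal.span ({X 0, X 1, X 2} : Set (MvPolynomial (Fin 3) (ZMod 2)))) ^ n ↔ n ≤ e := by
  rw [span_vars_eq_idealOfVars, X_pow_eq_monomial, MvPolynomial.monomial_mem_pow_idealOfVars_iff n _ one_ne_zero,
    Finsupp.degree_single]

/-! ### BV lineage: chart `ω₁` of the blow-up of `ξ`, section `y` -/

/-- [OURS · K2.2-S] Chart `ω₁` of the blow-up of `ξ` applied to W1's `g = y² + ε` (BV lineage, section `y` unchanged at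
`ξ`): `g(yω₁, ω₁, ω₂ω₁) = ω₁² · (y² + yω₁⁵ω₂ + yω₁ω₂ + ω₁²)`; the second factor is the strict transform `g′_BV`.
NOT a statement of the manuscript. [folklore] -/
theorem gW1_blowup_chart_omega1 :
    MvPolynomial.aeval ![(X 0 * X 1 : MvPolynomial (Fin 3) (ZMod 2)), X 1, X 2 * X 1]
        (X 0 ^ 2 + (X 0 * X 1 ^ 5 * X 2 + X 0 * X 1 * X 2 + X 1 ^ 4) : MvPolynomial (Fin 3) (ZMod 2)) =
      X 1 ^ 2 * (X 0 ^ 2 + (X 0 * X 1 ^ 5 * X 2 + X 0 * X 1 * X 2 + X 1 ^ 2)) := by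
  simp only [map_add, map_mul, map_pow, MvPolynomial.aeval_X, Matrix.cons_val_zero, Matrix.cons_val_one,
    Matrix.cons_val_two, Matrix.head_cons, Matrix.tail_cons]
  ring

/-- [OURS · K2.2-S] The monomial `ω₁²` lies in the support of `g′_BV − y² = yω₁⁵ω₂ + yω₁ω₂ + ω₁²`. [folklore] -/
theorem single_mem_support_gpBV_sub_ysq :
    (Finsupp.single 1 2 : Fin 3 →₀ ℕ) ∈
      ((X 0 ^ 2 + (X 0 * X 1 ^ 5 * X 2 + X 0 * X 1 * X 2 + X 1 ^ 2)) - X 0 ^ 2 :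
        MvPolynomial (Fin 3) (ZMod 2)).support := by
  rw [add_sub_cancel_left, MvPolynomial.mem_support_iff]
  have h1 : (X 0 * X 1 ^ 5 * X 2 : MvPolynomial (Fin 3) (ZMod 2)) =
      monomial (Finsupp.single 0 1 + Finsupp.single 1 5 + Finsupp.single 2 1) 1 := by
    simp [X, monomial_mul, monomial_pow]
  have h2 : (X 0 * X 1 * X 2 : MvPolynomial (Fin 3) (ZMod 2)) =
      monomial (Finsupp.single 0 1 + Finsupp.single 1 1 + Finsupp.single 2 1) 1 := by
    simp [X, monomial_mul]
  have h3 : (X 1 ^ 2 : MvPolynomial (Fin 3) (ZMod 2)) = monomial (Finsupp.single 1 2) 1 := by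
    simp [X, monomial_pow]
  rw [h1, h2, h3, coeff_add, coeff_add, coeff_monomial, coeff_monomial, coeff_monomial, if_neg, if_neg, if_pos rfl]
  · decide
  · intro h
    have := DFunLike.congr_fun h 0
    simp at this
  · intro h
    have := DFunLike.congr_fun h 0
    simp at this

/-- [OURS · K2.2-S] **BV tail after one domino, order test fails for the old section**: at the origin `ξ′` of the chart,
`g′_BV − y² = yω₁⁵ω₂ + yω₁ω₂ + ω₁² ∉ 𝔪³` — the strict transform of the BV section `y` is NOT order-safe at `ξ′`
(`ord_{ξ′}(g′ − y′²) = 2 = q`, not `> q`), kit j261337 §B2 row W1/BV/chart ω₁. NOT a statement of the manuscript. [folklore] -/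
theorem gpBV_sub_ysq_not_mem_cube :
    ((X 0 ^ 2 + (X 0 * X 1 ^ 5 * X 2 + X 0 * X 1 * X 2 + X 1 ^ 2)) - X 0 ^ 2 : MvPolynomial (Fin 3) (ZMod 2)) ∉
      (Ideal.span ({X 0, X 1, X 2} : Set (MvPolynomial (Fin 3) (ZMod 2)))) ^ 3 := by
  rw [span_vars_eq_idealOfVars, MvPolynomial.mem_pow_idealOfVars_iff]
  intro h
  have := h _ single_mem_support_gpBV_sub_ysq
  simp [Finsupp.degree_single] at this

/-- [OURS · K2.2-S] Re-cleaning after one domino is LINEAR: `g′_BV − (y + ω₁)² = yω₁⁵ω₂ + yω₁ω₂` in characteristic `2`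
(the initial form of `g′_BV` at `ξ′` is `(y′ + ω₁)²`). NOT a statement of the manuscript. [folklore] -/
theorem gpBV_sub_ylin_sq :
    ((X 0 ^ 2 + (X 0 * X 1 ^ 5 * X 2 + X 0 * X 1 * X 2 + X 1 ^ 2)) - (X 0 + X 1) ^ 2 :
      MvPolynomial (Fin 3) (ZMod 2)) = X 0 * X 1 ^ 5 * X 2 + X 0 * X 1 * X 2 := by
  linear_combination (-(X 0 * X 1 : MvPolynomial (Fin 3) (ZMod 2))) * two_eq_zero_A3

/-- [OURS · K2.2-S] After the linear re-translation `y″ = y′ + ω₁` the order test holds again at `ξ′`: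
`g′_BV − (y + ω₁)² ∈ 𝔪³`. NOT a statement of the manuscript. [folklore] -/
theorem gpBV_sub_ylin_sq_mem_cube :
    ((X 0 ^ 2 + (X 0 * X 1 ^ 5 * X 2 + X 0 * X 1 * X 2 + X 1 ^ 2)) - (X 0 + X 1) ^ 2 :
      MvPolynomial (Fin 3) (ZMod 2)) ∈
      (Ideal.span ({X 0, X 1, X 2} : Set (MvPolynomial (Fin 3) (ZMod 2)))) ^ 3 := by
  rw [gpBV_sub_ylin_sq, ← gW1_sub_yCS_sq]
  exact gW1_sub_yCS_sq_mem_cube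

/-- [OURS · K2.2-S] **«The BV tail turns»**: the re-translation `ω₁` forced at `ξ′` is NOT in `𝔪²` — the re-cleaned
section `y′ + ω₁` differs from the transformed BV section `y′` to first order (contrast K2.2's T2 at `ξ`,
`yCS_sub_y_mem_sq`: there the translation `ω₁²` lies in `𝔪²`). NOT a statement of the manuscript. [folklore] -/
theorem omega1_not_mem_sq :
    (X 1 : MvPolynomial (Fin 3) (ZMod 2)) ∉
      (Ideal.span ({X 0, X 1, X 2} : Set (MvPolynomial (Fin 3) (ZMod 2)))) ^ 2 := by
  have h := (X_pow_mem_vars_pow_iff 1 1 2).not.mpr (by norm_num)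
  simpa using h

/-! ### CS lineage: the same chart for the vertex-prepared section `z = y + ω₁²` -/

/-- [OURS · K2.2-S] W1 in the vertex-prepared coordinates `(z, ω₁, ω₂)`, `z = y + ω₁²` (so `y = z + ω₁²` in
characteristic `2`): `g(z + ω₁², ω₁, ω₂) = z² + zω₁⁵ω₂ + zω₁ω₂ + ω₁⁷ω₂ + ω₁³ω₂`. NOT a statement of the manuscript.
[folklore] -/
theorem gW1_in_zCS :
    MvPolynomial.aeval ![(X 0 + X 1 ^ 2 : MvPolynomial (Fin 3) (ZMod 2)), X 1, X 2]
        (X 0 ^ 2 + (X 0 * X 1 ^ 5 * X 2 + X 0 * X 1 * X 2 + X 1 ^ 4) : MvPolynomial (Fin 3) (ZMod 2)) =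
      X 0 ^ 2 + (X 0 * X 1 ^ 5 * X 2 + X 0 * X 1 * X 2 + X 1 ^ 7 * X 2 + X 1 ^ 3 * X 2) := by
  simp only [map_add, map_mul, map_pow, MvPolynomial.aeval_X, Matrix.cons_val_zero, Matrix.cons_val_one,
    Matrix.cons_val_two, Matrix.head_cons, Matrix.tail_cons]
  linear_combination (X 0 * X 1 ^ 2 + X 1 ^ 4 : MvPolynomial (Fin 3) (ZMod 2)) * two_eq_zero_A3

/-- [OURS · K2.2-S] Chart `ω₁` of the blow-up of `ξ` in the CS coordinates:
`g(zω₁, ω₁, ω₂ω₁) = ω₁² · (z² + zω₁ω₂ + zω₁⁵ω₂ + ω₁²ω₂ + ω₁⁶ω₂)`; the second factor is the strict transform `g′_CS`.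
NOT a statement of the manuscript. [folklore] -/
theorem gW1CS_blowup_chart_omega1 :
    MvPolynomial.aeval ![(X 0 * X 1 : MvPolynomial (Fin 3) (ZMod 2)), X 1, X 2 * X 1]
        (X 0 ^ 2 + (X 0 * X 1 ^ 5 * X 2 + X 0 * X 1 * X 2 + X 1 ^ 7 * X 2 + X 1 ^ 3 * X 2) :
          MvPolynomial (Fin 3) (ZMod 2)) =
      X 1 ^ 2 * (X 0 ^ 2 + (X 0 * X 1 * X 2 + X 0 * X 1 ^ 5 * X 2 + X 1 ^ 2 * X 2 + X 1 ^ 6 * X 2)) := by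
  simp only [map_add, map_mul, map_pow, MvPolynomial.aeval_X, Matrix.cons_val_zero, Matrix.cons_val_one,
    Matrix.cons_val_two, Matrix.head_cons, Matrix.tail_cons]
  ring

/-- [OURS · K2.2-S] **«The CS tail persists»**: at the origin `ξ′` of the chart the transformed vertex-prepared section
`z′` is still order-safe with NO re-translation: `g′_CS − z² = zω₁ω₂ + zω₁⁵ω₂ + ω₁²ω₂ + ω₁⁶ω₂ ∈ 𝔪³`
(kit j261337 §B2 row W1/CS/chart ω₁). NOT a statement of the manuscript. [folklore] -/
theorem gpCS_sub_zsq_mem_cube :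
    ((X 0 ^ 2 + (X 0 * X 1 * X 2 + X 0 * X 1 ^ 5 * X 2 + X 1 ^ 2 * X 2 + X 1 ^ 6 * X 2)) - X 0 ^ 2 :
      MvPolynomial (Fin 3) (ZMod 2)) ∈
      (Ideal.span ({X 0, X 1, X 2} : Set (MvPolynomial (Fin 3) (ZMod 2)))) ^ 3 := by
  rw [add_sub_cancel_left]
  set m : Ideal (MvPolynomial (Fin 3) (ZMod 2)) :=
    Ideal.span ({X 0, X 1, X 2} : Set (MvPolynomial (Fin 3) (ZMod 2)))
  have h0 : (X 0 : MvPolynomial (Fin 3) (ZMod 2)) ∈ m := Ideal.subset_span (by simp)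
  have h1 : (X 1 : MvPolynomial (Fin 3) (ZMod 2)) ∈ m := Ideal.subset_span (by simp)
  have h2 : (X 2 : MvPolynomial (Fin 3) (ZMod 2)) ∈ m := Ideal.subset_span (by simp)
  have hA : (X 0 * X 1 * X 2 : MvPolynomial (Fin 3) (ZMod 2)) ∈ m ^ 3 := by
    rw [pow_succ, pow_succ, pow_one]
    exact Ideal.mul_mem_mul (Ideal.mul_mem_mul h0 h1) h2
  have hB : (X 1 * X 1 * X 2 : MvPolynomial (Fin 3) (ZMod 2)) ∈ m ^ 3 := by
    rw [pow_succ, pow_succ, pow_one]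
    exact Ideal.mul_mem_mul (Ideal.mul_mem_mul h1 h1) h2
  have : (X 0 * X 1 * X 2 + X 0 * X 1 ^ 5 * X 2 + X 1 ^ 2 * X 2 + X 1 ^ 6 * X 2 : MvPolynomial (Fin 3) (ZMod 2)) =
      (X 0 * X 1 * X 2) * (1 + X 1 ^ 4) + (X 1 * X 1 * X 2) * (1 + X 1 ^ 4) := by ring
  rw [this]
  exact Ideal.add_mem _ (Ideal.mul_mem_right _ _ hA) (Ideal.mul_mem_right _ _ hB)

/-- [OURS · K2.2-S] The two lineages agree after re-cleaning: substituting the re-linearised BV section,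
`g′_BV(z + ω₁, ω₁, ω₂) = g′_CS(z, ω₁, ω₂)` — i.e. `z′ = y′ + ω₁`: the linear turn of the BV tail at `ξ′` lands exactly
on the strict transform of the vertex-prepared section. NOT a statement of the manuscript. [folklore] -/
theorem gpBV_relinearised_eq_gpCS :
    MvPolynomial.aeval ![(X 0 + X 1 : MvPolynomial (Fin 3) (ZMod 2)), X 1, X 2]
        (X 0 ^ 2 + (X 0 * X 1 ^ 5 * X 2 + X 0 * X 1 * X 2 + X 1 ^ 2) : MvPolynomial (Fin 3) (ZMod 2)) =
      X 0 ^ 2 + (X 0 * X 1 * X 2 + X 0 * X 1 ^ 5 * X 2 + X 1 ^ 2 * X 2 + X 1 ^ 6 * X 2) := by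
  simp only [map_add, map_mul, map_pow, MvPolynomial.aeval_X, Matrix.cons_val_zero, Matrix.cons_val_one,
    Matrix.cons_val_two, Matrix.head_cons, Matrix.tail_cons]
  linear_combination (X 0 * X 1 + X 1 ^ 2 : MvPolynomial (Fin 3) (ZMod 2)) * two_eq_zero_A3

end OneDominoW1

section BVCaseAOnW1

/-! ### Benito–Villamayor at `ξ` on W1: case A) — no cleaning step (res-lit-3's coefficient-level vocabulary)
Base ring `𝔽₂⟦ω₁, ω₂⟧ = MvPowerSeries (Fin 2) (ZMod 2)` (`0 = ω₁`, `1 = ω₂`; the complete local ring of the plane of the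
transversal projection `(y, ω₁, ω₂) ↦ (ω₁, ω₂)`), `p`-presentation polynomial `f(z) = z² + a₁ z + a₂` with `a₁ = ω₁⁵ω₂ + ω₁ω₂`,
`a₂ = ω₁⁴` (W1's `g` read as a polynomial in `y`). Orders: `ν(a₁) = 2`, `ν(a₂) = 4`, so `ν(a₂)/2 = 2 = ν(a₁)/1`: the
minimum of Def. 4.2 is attained at `j = 1 < q = 2` and the sharpened case-B) condition (5.3.1) of Prop. 5.3 fails, for
every value of the parameter `ρ` that stands for `ord(ℛ_{𝒢,β})(ξ)` (not typed in the tree). -/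

open MvPowerSeries Literature.AlgebraicGeometry.Resolution

/-- [folklore] Bridge on `𝔽₂⟦ω₁, ω₂⟧`: the tree's `𝔪`-adic order `Resolution.adicOrder` is Mathlib's `MvPowerSeries.order`
(via the tree's `Jets.le_order_iff_mem_maximalIdeal_pow`; same two lines as in `S09LLUED/Eq83b.lean`). -/
theorem adicOrder_eq_order_F2 (f : MvPowerSeries (Fin 2) (ZMod 2)) : adicOrder f = f.order := by
  apply le_antisymm
  · refine ENat.forall_natCast_le_iff_le.mp fun k hk => ?_
    exact Literature.RingTheory.MvPowerSeries.Jets.le_order_iff_mem_maximalIdeal_pow.mpr ((le_adicOrder_iff f k).mp hk)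
  · refine ENat.forall_natCast_le_iff_le.mp fun k hk => ?_
    exact (le_adicOrder_iff f k).mpr (Literature.RingTheory.MvPowerSeries.Jets.le_order_iff_mem_maximalIdeal_pow.mp hk)

/-- [OURS · K2.2] `ν(a₂) = ν(ω₁⁴) = 4` in `𝔽₂⟦ω₁, ω₂⟧`. [folklore] -/
theorem adicOrder_a2_W1 : adicOrder ((X 0 : MvPowerSeries (Fin 2) (ZMod 2)) ^ 4) = ((4 : ℕ) : ℕ∞) := by
  rw [adicOrder_eq_order_F2, X_pow_eq, order_monomial_of_ne_zero one_ne_zero, Finsupp.degree_single]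

/-- [OURS · K2.2] `ν(a₁) = ν(ω₁⁵ω₂ + ω₁ω₂) = 2` in `𝔽₂⟦ω₁, ω₂⟧`. [folklore] -/
theorem adicOrder_a1_W1 :
    adicOrder ((X 0 : MvPowerSeries (Fin 2) (ZMod 2)) ^ 5 * X 1 + X 0 * X 1) = ((2 : ℕ) : ℕ∞) := by
  have e1 : ((X 0 : MvPowerSeries (Fin 2) (ZMod 2)) ^ 5 * X 1) =
      monomial (Finsupp.single 0 5 + Finsupp.single 1 1) (1 : ZMod 2) := by
    rw [X_pow_eq, X_def, monomial_mul_monomial, one_mul]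
  have e2 : ((X 0 : MvPowerSeries (Fin 2) (ZMod 2)) * X 1) =
      monomial (Finsupp.single 0 1 + Finsupp.single 1 1) (1 : ZMod 2) := by
    rw [X_def, X_def, monomial_mul_monomial, one_mul]
  have o1 : ((X 0 : MvPowerSeries (Fin 2) (ZMod 2)) ^ 5 * X 1).order = ((6 : ℕ) : ℕ∞) := by
    rw [e1, order_monomial_of_ne_zero one_ne_zero, map_add, Finsupp.degree_single, Finsupp.degree_single]
  have o2 : ((X 0 : MvPowerSeries (Fin 2) (ZMod 2)) * X 1).order = ((2 : ℕ) : ℕ∞) := by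
    rw [e2, order_monomial_of_ne_zero one_ne_zero, map_add, Finsupp.degree_single, Finsupp.degree_single]
  have hne : ((X 0 : MvPowerSeries (Fin 2) (ZMod 2)) ^ 5 * X 1).order ≠
      ((X 0 : MvPowerSeries (Fin 2) (ZMod 2)) * X 1).order := by
    rw [o1, o2]
    exact_mod_cast (by norm_num : (6 : ℕ) ≠ 2)
  rw [adicOrder_eq_order_F2, order_add_of_order_ne hne, o1, o2]
  exact min_eq_right (by exact_mod_cast (by norm_num : (2 : ℕ) ≤ 6))

/-- [OURS · K2.2] `a₂ = ω₁⁴`: the last coefficient of W1's presentation polynomial `f(z) = z² + (ω₁⁵ω₂ + ω₁ω₂) z + ω₁⁴`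
(unfolding of `BV2013.coeffA`). [folklore] -/
theorem coeffA_fW1_two :
    BV2013.coeffA 2
      (Polynomial.X ^ 2 + Polynomial.C ((X 0 : MvPowerSeries (Fin 2) (ZMod 2)) ^ 5 * X 1 + X 0 * X 1) *
          Polynomial.X + Polynomial.C ((X 0 : MvPowerSeries (Fin 2) (ZMod 2)) ^ 4)) 2 =
        (X 0 : MvPowerSeries (Fin 2) (ZMod 2)) ^ 4 := by
  simp only [BV2013.coeffA, Polynomial.coeff_add, Polynomial.coeff_X_pow, Polynomial.coeff_C_mul_X,
    Polynomial.coeff_C, Nat.reduceSub, Nat.reduceEqDiff, ↓reduceIte, zero_add, add_zero]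

/-- [OURS · K2.2] `a₁ = ω₁⁵ω₂ + ω₁ω₂`: the middle coefficient of W1's presentation polynomial (unfolding of
`BV2013.coeffA`). [folklore] -/
theorem coeffA_fW1_one :
    BV2013.coeffA 2
      (Polynomial.X ^ 2 + Polynomial.C ((X 0 : MvPowerSeries (Fin 2) (ZMod 2)) ^ 5 * X 1 + X 0 * X 1) *
          Polynomial.X + Polynomial.C ((X 0 : MvPowerSeries (Fin 2) (ZMod 2)) ^ 4)) 1 =
        (X 0 : MvPowerSeries (Fin 2) (ZMod 2)) ^ 5 * X 1 + X 0 * X 1 := by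
  simp only [BV2013.coeffA, Polynomial.coeff_add, Polynomial.coeff_X_pow, Polynomial.coeff_C_mul_X,
    Polynomial.coeff_C, Nat.reduceSub, Nat.reduceEqDiff, ↓reduceIte, zero_add, add_zero]

/-- [OURS · K2.2] The coefficient part of the slope of Def. 4.2 on W1 is `min(ν(a₁)/1, ν(a₂)/2) = 2`, so
`Sl = min(2, ρ)` (`ρ` for the untyped `ord(ℛ_{𝒢,β})(ξ)`). NOT a statement of the manuscript. [folklore] -/
theorem bvW1_slope (ρ : ℚ) :
    BV2013.slope 2
      (Polynomial.X ^ 2 + Polynomial.C ((X 0 : MvPowerSeries (Fin 2) (ZMod 2)) ^ 5 * X 1 + X 0 * X 1) *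
          Polynomial.X + Polynomial.C ((X 0 : MvPowerSeries (Fin 2) (ZMod 2)) ^ 4)) ρ =
        ((2 : ℚ) : WithTop ℚ) ⊓ ((ρ : ℚ) : WithTop ℚ) := by
  unfold BV2013.slope
  have hIcc : Finset.Icc 1 2 = ({1, 2} : Finset ℕ) := by decide
  rw [hIcc, Finset.inf_insert, Finset.inf_singleton, coeffA_fW1_one, coeffA_fW1_two,
    BV2013.ordQuot_of_eq_natCast adicOrder_a1_W1 1, BV2013.ordQuot_of_eq_natCast adicOrder_a2_W1 2]
  norm_num

/-- [OURS · K2.2] **Benito–Villamayor makes no cleaning step at `ξ` on W1**: for `f(z) = z² + (ω₁⁵ω₂ + ω₁ω₂) z + ω₁⁴`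
over `𝔽₂⟦ω₁, ω₂⟧` the sharpened case-B) condition (5.3.1) «`ν(a_q)/q < ν(a_j)/j` for `1 ≤ j < q`» of
[BenitoVillamayoru2013] Prop. 5.3 (tree `BV2013.IsCaseB`, res-lit-3 p470373) FAILS for every `ρ`
(`ν(a₂)/2 = 4/2 = 2 = ν(a₁)/1`): Prop. 5.3 offers no slope-raising change of section, the output section is `y`, and
`ω₁⁴` stays in the tail (kit j258474 row W1/BV, «case A: slope 2 attained by a₁»). Uses only the coefficient-level
rendering; `ρ` stands for the untyped `ord(ℛ_{𝒢,β})(ξ)`. NOT a statement of the manuscript or a claim about the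
cited paper beyond its typed rendering. [folklore] -/
theorem bvW1_not_isCaseB (ρ : ℚ) :
    ¬ BV2013.IsCaseB 2
        (Polynomial.X ^ 2 + Polynomial.C ((X 0 : MvPowerSeries (Fin 2) (ZMod 2)) ^ 5 * X 1 + X 0 * X 1) *
            Polynomial.X + Polynomial.C ((X 0 : MvPowerSeries (Fin 2) (ZMod 2)) ^ 4)) ρ := by
  rintro ⟨_, h⟩
  have hlt := h 1 (Finset.mem_Ico.mpr ⟨le_rfl, one_lt_two⟩)
  rw [coeffA_fW1_one, coeffA_fW1_two, BV2013.ordQuot_of_eq_natCast adicOrder_a2_W1 2,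
    BV2013.ordQuot_of_eq_natCast adicOrder_a1_W1 1, WithTop.coe_lt_coe] at hlt
  norm_num at hlt

/-- [OURS · K2.2] Hence, under the conclusion of [BenitoVillamayoru2013] Thm. 4.6 for this presentation (tree hypothesis
predicate `BV2013.SlopeDichotomy`, res-lit-6 p475767), W1's presentation at `ξ` is in case A) of §5.1
(`Sl = ord(ℛ_{𝒢,β})(ξ)`): the Benito–Villamayor cleaning process stops at once with the section `y`. NOT a statement of
the manuscript; the named paper enters only through its typed coefficient-level rendering. [folklore] -/
theorem bvW1_isCaseA_of_slopeDichotomy (ρ : ℚ)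
    (h46 : BV2013.SlopeDichotomy 2
      (Polynomial.X ^ 2 + Polynomial.C ((X 0 : MvPowerSeries (Fin 2) (ZMod 2)) ^ 5 * X 1 + X 0 * X 1) *
          Polynomial.X + Polynomial.C ((X 0 : MvPowerSeries (Fin 2) (ZMod 2)) ^ 4)) ρ) :
    BV2013.IsCaseA 2
      (Polynomial.X ^ 2 + Polynomial.C ((X 0 : MvPowerSeries (Fin 2) (ZMod 2)) ^ 5 * X 1 + X 0 * X 1) *
          Polynomial.X + Polynomial.C ((X 0 : MvPowerSeries (Fin 2) (ZMod 2)) ^ 4)) ρ :=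
  (BV2013.isCaseA_or_isCaseB_of_slopeDichotomy two_pos h46).resolve_right (bvW1_not_isCaseB ρ)


/-- [OURS · K2.2] **BV stops at `ξ` on W1 with the section `y`**: under the conclusion of Thm. 4.6 (`BV2013.SlopeDichotomy`)
and for a positive value of the parameter `ρ` (`ord(ℛ_{𝒢,β})(ξ) > 0`, i.e. `ξ ∈ Sing`), W1's presentation at `ξ` is
WELL-ADAPTED in the sense of [BenitoVillamayoru2013] Def. 5.5 (1) (tree `BV2013.IsWellAdapted`, case A) with
`Sl = min(2, ρ) > 0`) — the state at which the cleaning procedure of Rem. 5.7 stops. NOT a statement of the manuscript;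
the named paper enters only through its typed coefficient-level rendering. [folklore] -/
theorem bvW1_isWellAdapted_of_slopeDichotomy (ρ : ℚ) (hρ : 0 < ρ)
    (h46 : BV2013.SlopeDichotomy 2
      (Polynomial.X ^ 2 + Polynomial.C ((X 0 : MvPowerSeries (Fin 2) (ZMod 2)) ^ 5 * X 1 + X 0 * X 1) *
          Polynomial.X + Polynomial.C ((X 0 : MvPowerSeries (Fin 2) (ZMod 2)) ^ 4)) ρ) :
    BV2013.IsWellAdapted 2
      (Polynomial.X ^ 2 + Polynomial.C ((X 0 : MvPowerSeries (Fin 2) (ZMod 2)) ^ 5 * X 1 + X 0 * X 1) *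
          Polynomial.X + Polynomial.C ((X 0 : MvPowerSeries (Fin 2) (ZMod 2)) ^ 4)) ρ :=
  Or.inl ⟨by
    rw [bvW1_slope]
    exact lt_inf_iff.mpr ⟨WithTop.coe_pos.mpr two_pos, WithTop.coe_pos.mpr hρ⟩,
    Or.inl (bvW1_isCaseA_of_slopeDichotomy ρ h46)⟩

end BVCaseAOnW1

end Summit.ResolutionOfSingularities.ResolutionOfSingularities.Theorems.Campaign.W22
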